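import Literature.Barriers.CriticalPhenomena.GridSAWTowersEnumeration
import Literature.Computability.Complexity.FoldBricks
import Literature.Computability.Complexity.ListFoldChecks
import Literature.Computability.Complexity.ZIntBricks
import Literature.Computability.Complexity.StackBricksStrings
import HarnessLib

/-!
# Tower step of Theorem 7 (1) (Liśkiewicz–Ogihara–Toda 2003), machine part (T3): the GENERATOR
# of the code of `E₂` — the piece function as a brick assembly, and the clipped fold

Sibling of `GridSAWTowersEnumeration.lean` (WHAT the generator emits: the flat pieces
`pieceFlat Λ D c i` of the items code of `E₂ = drawnEdges (uniformize P D).2`, in mixed radix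
`(e, q, t, m)`, `framesOf_drawnEdges_uniformize`; and the closed form of a piece,
`getElem?_blockEdges`/`towerBlockPt`) and of `GridSAWTowersReduction.lean` (the instance map
`towerCode`, the named machine fact `LOT2003_thm7_fixedLength_towers_FP : towerCode ∈ FP`). This
file builds HOW it is emitted, in the tree's `FP` brick algebra (`BrickAlgebra`, `FoldBricks`,
`HashBricks`, `PlumbingBricks`, `ZIntBricks`, `StackBricksStrings`), with no machine written:

* the **context** `ctx w Λ v = ⟨w, ⟨1^Λ, ⟨dpEnc v.1, dpEnc v.2⟩⟩⟩` (canonical presentation code,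
  `Λ = maxEdges D` in unary, translation vector as difference pairs) and the piece argument
  `arg … i = ⟨ctx, 1ⁱ⟩`; projections `wF`, `lamF`, `v1F`, `v2F`, `idxF`, and the unary constants
  `uMF = 1^{24Λ}`, `uBF = 1^{12Λ+2}`, `u8F`, `u6F`;
* **Stage A** `dm1F`/`dm2F`/`dm3F`, `ueF`, `uqF`, `utF`, `umF`: the indices `(e, q, t, m)` in
  unary by `Plumb.divModFn` and `HashBricks.umulFn` (`idxE`, `idxQ`, `idxT`, `idxM`;
  `pieceFlat_eq`);
* **Stage B** `dF`, `paF`, `pbF`: the drawn edge `D[e]` and the points `π[q]`, `π[q+1]` by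
  `HashBricks.nthItemFn` on the canonical code (`encDG_eq`, `encDE_eq`, `encPL_eq`,
  `nthItemFn_encList_map`);
* **Stage C** `c1F = [e < |D|]`, `c2F = [q + 1 < |π|]`, `towF` (the tower condition
  `q = 0 ∧ 8Λ ≤ t < 8Λ + 4(Λ - λ) ∧ 2 ∣ t - 8Λ`, `mem_towerOffsets_iff`), `hF = 1^{h'}` (`hgt`),
  `c3F = [m ≤ 2h']`, `rangeF`, with their truth lemmas (`rangeF_argOf_eq_true_iff`);
* **Stage D** `ptF jF`: the sign–magnitude code of the translated `j`-th point of the block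
  (`towerBlockPt`: column `t`/`t+1`, height `j`/`2h'+1-j`, `towerPt M a u c k = M a + c u + k rot u`
  with `ZIntBricks` arithmetic; `ptF_argOf`: `= encPt (blockPt … j + v)`);
* **`pieceFn`** `= iteFn rangeF ⟨⟨ptF (1ᵐ), ptF (1^{m+1})⟩, ε⟩ ε` and **`pieceFn_argOf`**:
  `pieceFn ⟨ctx, 1ⁱ⟩ = pieceFlat Λ D (cV v) i` for EVERY `i` (`cV v` = the pair code of the edge
  moved by `v`); `pieceFn_mem_FP`;
* the trajectory bound `length_pieceFn_argOf_le` (pieces have at most `pieceClip · (|ctx| + 1)`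
  symbols when the drawn paths are grid chains: coordinates are `M a + c u ± k u' + v` with unit
  `u`, `u'` and `c, k ≤ M < 2^{Λ+5}`), so that clipping (`Brick.clipF`, which gives the fold its
  unconditional growth bound) never bites where the value matters (`foldAcc_clipF`);
* **`genItemsFn = sndPow 2 ∘ foldLoop appF (clipF pieceClip pieceFn) genPoly ∘ genInitF`**
  (`genPoly = 336 (X+1)⁴ ≥ totalPieces`), **`genItemsFn_mem_FP`**, and **`genItemsFn_ctx`**:
  for a valid drawing, `genItemsFn (ctx (encode (P, D, s, t)) (maxEdges D) v) =
  framesOf (cV v) (drawnEdges (uniformize P D).2)` — the items part of the `Encoding.listBool`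
  code of `translate v E₂`, i.e. of the first component of `towerInstance` for `v = -P₂[s]`.

What remains of (T3) after this file: the context builder from the canonical code (`1^Λ` by a
max-fold over the edge headers; `-P₂[s]` by an index look-up with `binToUnaryFn`), the three small
fields (unary header `1^{|D|·24Λ²}`, `P₂[t] - P₂[s]`, `bin (24Λ²(N-1))`), the branch on validity
/ `N = 1` (the validity test is `GridSAWDrawingChecker.lean`, the input canonicaliser
`GridSAWInstanceCanon.lean`), and the final comparison with `towerCode`.

## References

* M. Liśkiewicz, M. Ogihara, S. Toda, *The complexity of counting self-avoiding walks in
  subgraphs of two-dimensional grids and hypercubes*, TCS 304 (2003) 129–156, §4, proof of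
  Theorem 7 (`R₁(x) = (E₂, τ, h)`; `E₂` by runs and towers).
* S. Arora, B. Barak, *Computational Complexity: A Modern Approach*, CUP 2009, §1.3 (polynomial
  time is closed under composition and bounded loops), §0.1 (codes of pairs and lists).
-/

noncomputable section

namespace Literature.Barriers.CriticalPhenomena.GridSAW

open _root_.Computability Literature.Computability.Complexity Literature.Computability.Complexity.Brick
  Polynomial

namespace TowerGen

/-! ### Small generic bricks -/

/-- `natZF (1ⁿ) = dpEnc n`: the difference-pair code of the value of a unary numeral
(`⟨bin n, ε⟩`). [folklore] -/
def natZF : List Bool → List Bool := fanoutFn HashBricks.popCountFn fun _ => []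

/-- `natZF ∈ FP`. [folklore] -/
theorem natZF_mem_FP : natZF ∈ FP := fanoutFn_mem_FP HashBricks.popCountFn_mem_FP (const_mem_FP _)

/-- `natZF (1ⁿ) = dpEnc n`. [folklore] -/
@[simp] theorem natZF_ones (n : ℕ) : natZF (ones n) = dpEnc n := by
  simp [natZF, ones, dpEnc, List.count_replicate_self]
  rfl

/-- The binary numeral of a unary one: `popCountFn (1ⁿ) = bin n`. [folklore] -/
@[simp] theorem popCountFn_ones (n : ℕ) : HashBricks.popCountFn (ones n) = encodeNat n := by
  simp [ones, List.count_replicate_self]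

/-- `onesMulFn k (1ⁿ) = 1^{k n}`. [folklore] -/
@[simp] theorem onesMulFn_ones (k n : ℕ) : onesMulFn k (ones n) = ones (k * n) := by
  simp [onesMulFn, ones]

/-- Dropping from a unary numeral subtracts. [folklore] -/
@[simp] theorem dropFn_boolPair_ones (a b : ℕ) : Plumb.dropFn (boolPair (ones a) (ones b)) = ones (b - a) := by
  rw [Plumb.dropFn_boolPair]
  simp [ones, List.drop_replicate]

/-- `ltLenF` on unary numerals compares. [folklore] -/
theorem ltLenF_ones (a b : ℕ) : ltLenF (boolPair (ones a) (ones b)) = [decide (a < b)] := by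
  rw [ltLenF_boolPair]; simp [ones]

/-- Parity of a canonical binary numeral. [folklore] -/
@[simp] theorem parityFn_encodeNat (n : ℕ) : parityFn (encodeNat n) = [decide (Even n)] := by
  simp [parityFn]

/-! ### The context record and the argument of the piece function -/

/-- **The context** handed to every piece: the canonical presentation code `w = ⟨P, ⟨D, ⟨s, t⟩⟩⟩`,
the unary `1^Λ` (`Λ = maxEdges D`), and the translation vector as two difference pairs.
[folklore] -/
def ctx (w : List Bool) (Λ : ℕ) (v : GridPoint) : List Bool :=
  boolPair w (boolPair (ones Λ) (boolPair (dpEnc v.1) (dpEnc v.2)))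

/-- The argument of the piece at position `i`: `⟨context, 1ⁱ⟩`. [folklore] -/
def arg (w : List Bool) (Λ : ℕ) (v : GridPoint) (i : ℕ) : List Bool := boolPair (ctx w Λ v) (ones i)

/-- Field: the presentation code. [folklore] -/
def wF : List Bool → List Bool := nthF 0 ∘ fstF
/-- Field: `1^Λ`. [folklore] -/
def lamF : List Bool → List Bool := nthF 1 ∘ fstF
/-- Field: `dpEnc v.1`. [folklore] -/
def v1F : List Bool → List Bool := nthF 2 ∘ fstF
/-- Field: `dpEnc v.2`. [folklore] -/
def v2F : List Bool → List Bool := sndPow 2 ∘ fstF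
/-- Field: `1ⁱ`. [folklore] -/
def idxF : List Bool → List Bool := sndF

/-- Value of `wF` on the piece argument of a presentation. [folklore] -/
theorem wF_arg (w : List Bool) (Λ : ℕ) (v : GridPoint) (i : ℕ) : wF (arg w Λ v i) = w := by simp [wF, arg, ctx]
/-- Value of `lamF` on the piece argument of a presentation. [folklore] -/
theorem lamF_arg (w : List Bool) (Λ : ℕ) (v : GridPoint) (i : ℕ) : lamF (arg w Λ v i) = ones Λ := by
  simp [lamF, arg, ctx]
/-- Value of `v1F` on the piece argument of a presentation. [folklore] -/
theorem v1F_arg (w : List Bool) (Λ : ℕ) (v : GridPoint) (i : ℕ) : v1F (arg w Λ v i) = dpEnc v.1 := by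
  simp [v1F, arg, ctx]
/-- Value of `v2F` on the piece argument of a presentation. [folklore] -/
theorem v2F_arg (w : List Bool) (Λ : ℕ) (v : GridPoint) (i : ℕ) : v2F (arg w Λ v i) = dpEnc v.2 := by
  simp [v2F, arg, ctx, sndPow]
/-- Value of `idxF` on the piece argument of a presentation. [folklore] -/
theorem idxF_arg (w : List Bool) (Λ : ℕ) (v : GridPoint) (i : ℕ) : idxF (arg w Λ v i) = ones i := by
  simp [idxF, arg]

/-- `wF ∈ FP`. [folklore] -/
theorem wF_mem_FP : wF ∈ FP := comp_mem_FP (nthF_mem_FP 0) fstF_mem_FP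
/-- `lamF ∈ FP`. [folklore] -/
theorem lamF_mem_FP : lamF ∈ FP := comp_mem_FP (nthF_mem_FP 1) fstF_mem_FP
/-- `v1F ∈ FP`. [folklore] -/
theorem v1F_mem_FP : v1F ∈ FP := comp_mem_FP (nthF_mem_FP 2) fstF_mem_FP
/-- `v2F ∈ FP`. [folklore] -/
theorem v2F_mem_FP : v2F ∈ FP := comp_mem_FP (sndPow_mem_FP 2) fstF_mem_FP
/-- `idxF ∈ FP`. [folklore] -/
theorem idxF_mem_FP : idxF ∈ FP := sndF_mem_FP

/-! ### Derived unary constants `24Λ`, `12Λ + 2`, `8Λ`, `6Λ` -/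

/-- `1^{24Λ}` (`M = bigM Λ`). [folklore] -/
def uMF : List Bool → List Bool := onesMulFn 24 ∘ lamF
/-- `1^{12Λ + 2}` (`radixB Λ`). [folklore] -/
def uBF : List Bool → List Bool := fun y => onesMulFn 12 (lamF y) ++ [true, true]
/-- `1^{8Λ}` (start of the tower zone). [folklore] -/
def u8F : List Bool → List Bool := onesMulFn 8 ∘ lamF
/-- `1^{6Λ}` (tower height). [folklore] -/
def u6F : List Bool → List Bool := onesMulFn 6 ∘ lamF

/-- Value of `uMF` on the piece argument of a presentation. [folklore] -/
theorem uMF_arg (w : List Bool) (Λ : ℕ) (v : GridPoint) (i : ℕ) : uMF (arg w Λ v i) = ones (bigM Λ) := by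
  simp [uMF, lamF_arg, bigM]
/-- Value of `uBF` on the piece argument of a presentation. [folklore] -/
theorem uBF_arg (w : List Bool) (Λ : ℕ) (v : GridPoint) (i : ℕ) : uBF (arg w Λ v i) = ones (radixB Λ) := by
  rw [uBF, lamF_arg, onesMulFn_ones, show [true, true] = ones 2 from rfl, Com.ones_append, radixB]
/-- Value of `u8F` on the piece argument of a presentation. [folklore] -/
theorem u8F_arg (w : List Bool) (Λ : ℕ) (v : GridPoint) (i : ℕ) : u8F (arg w Λ v i) = ones (8 * Λ) := by
  simp [u8F, lamF_arg]
/-- Value of `u6F` on the piece argument of a presentation. [folklore] -/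
theorem u6F_arg (w : List Bool) (Λ : ℕ) (v : GridPoint) (i : ℕ) : u6F (arg w Λ v i) = ones (6 * Λ) := by
  simp [u6F, lamF_arg]

/-- `uMF ∈ FP`. [folklore] -/
theorem uMF_mem_FP : uMF ∈ FP := comp_mem_FP (onesMulFn_mem_FP 24) lamF_mem_FP
/-- `uBF ∈ FP`. [folklore] -/
theorem uBF_mem_FP : uBF ∈ FP := append_mem_FP (comp_mem_FP (onesMulFn_mem_FP 12) lamF_mem_FP) (const_mem_FP _)
/-- `u8F ∈ FP`. [folklore] -/
theorem u8F_mem_FP : u8F ∈ FP := comp_mem_FP (onesMulFn_mem_FP 8) lamF_mem_FP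
/-- `u6F ∈ FP`. [folklore] -/
theorem u6F_mem_FP : u6F ∈ FP := comp_mem_FP (onesMulFn_mem_FP 6) lamF_mem_FP

/-! ### Stage A: the mixed-radix indices `(e, q, t, m)` in unary -/

/-- `⟨1ᵉ, 1^{r₁}⟩ = divmod (i, Λ · M · B)`. [folklore] -/
def dm1F : List Bool → List Bool :=
  Plumb.divModFn ∘ fanoutFn (HashBricks.umulFn ∘ fanoutFn lamF (HashBricks.umulFn ∘ fanoutFn uMF uBF)) idxF
/-- `⟨1^q, 1^{r₂}⟩ = divmod (r₁, M · B)`. [folklore] -/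
def dm2F : List Bool → List Bool :=
  Plumb.divModFn ∘ fanoutFn (HashBricks.umulFn ∘ fanoutFn uMF uBF) (sndF ∘ dm1F)
/-- `⟨1ᵗ, 1ᵐ⟩ = divmod (r₂, B)`. [folklore] -/
def dm3F : List Bool → List Bool := Plumb.divModFn ∘ fanoutFn uBF (sndF ∘ dm2F)

/-- `1ᵉ`. [folklore] -/
def ueF : List Bool → List Bool := fstF ∘ dm1F
/-- `1^q`. [folklore] -/
def uqF : List Bool → List Bool := fstF ∘ dm2F
/-- `1ᵗ`. [folklore] -/
def utF : List Bool → List Bool := fstF ∘ dm3F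
/-- `1ᵐ`. [folklore] -/
def umF : List Bool → List Bool := sndF ∘ dm3F

section IdxApply

variable (w : List Bool) (Λ : ℕ) (v : GridPoint) (i : ℕ)

/-- Value of `dm1F` on the piece argument of a presentation. [folklore] -/
theorem dm1F_arg : dm1F (arg w Λ v i) =
    boolPair (ones (i / (Λ * (bigM Λ * radixB Λ)))) (ones (i % (Λ * (bigM Λ * radixB Λ)))) := by
  simp only [dm1F, Function.comp_apply, fanoutFn_apply, lamF_arg, uMF_arg, uBF_arg, idxF_arg,
    HashBricks.umulFn_boolPair, Plumb.divModFn_boolPair]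

/-- Value of `dm2F` on the piece argument of a presentation. [folklore] -/
theorem dm2F_arg : dm2F (arg w Λ v i) =
    boolPair (ones (i % (Λ * (bigM Λ * radixB Λ)) / (bigM Λ * radixB Λ)))
      (ones (i % (Λ * (bigM Λ * radixB Λ)) % (bigM Λ * radixB Λ))) := by
  simp only [dm2F, Function.comp_apply, fanoutFn_apply, uMF_arg, uBF_arg, dm1F_arg, sndF_boolPair,
    HashBricks.umulFn_boolPair, Plumb.divModFn_boolPair]

/-- Value of `dm3F` on the piece argument of a presentation. [folklore] -/
theorem dm3F_arg : dm3F (arg w Λ v i) =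
    boolPair (ones (i % (Λ * (bigM Λ * radixB Λ)) % (bigM Λ * radixB Λ) / radixB Λ))
      (ones (i % (Λ * (bigM Λ * radixB Λ)) % (bigM Λ * radixB Λ) % radixB Λ)) := by
  simp only [dm3F, Function.comp_apply, fanoutFn_apply, uBF_arg, dm2F_arg, sndF_boolPair,
    Plumb.divModFn_boolPair]

/-- The radix components read off the argument. [folklore] -/
def idxE : ℕ := i / (Λ * (bigM Λ * radixB Λ))
/-- (see `idxE`) [folklore] -/
def idxQ : ℕ := i % (Λ * (bigM Λ * radixB Λ)) / (bigM Λ * radixB Λ)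
/-- (see `idxE`) [folklore] -/
def idxT : ℕ := i % (Λ * (bigM Λ * radixB Λ)) % (bigM Λ * radixB Λ) / radixB Λ
/-- (see `idxE`) [folklore] -/
def idxM : ℕ := i % (Λ * (bigM Λ * radixB Λ)) % (bigM Λ * radixB Λ) % radixB Λ

/-- Value of `ueF` on the piece argument of a presentation. [folklore] -/
theorem ueF_arg : ueF (arg w Λ v i) = ones (idxE Λ i) := by simp [ueF, dm1F_arg, idxE]
/-- Value of `uqF` on the piece argument of a presentation. [folklore] -/
theorem uqF_arg : uqF (arg w Λ v i) = ones (idxQ Λ i) := by simp [uqF, dm2F_arg, idxQ]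
/-- Value of `utF` on the piece argument of a presentation. [folklore] -/
theorem utF_arg : utF (arg w Λ v i) = ones (idxT Λ i) := by simp [utF, dm3F_arg, idxT]
/-- Value of `umF` on the piece argument of a presentation. [folklore] -/
theorem umF_arg : umF (arg w Λ v i) = ones (idxM Λ i) := by simp [umF, dm3F_arg, idxM]

/-- The flat piece through the radix components. [folklore] -/
theorem pieceFlat_eq (D : List DrawnEdge) (c : GridPoint × GridPoint → List Bool) :
    pieceFlat Λ D c i = pieceAt Λ D c (idxE Λ i) (idxQ Λ i) (idxT Λ i) (idxM Λ i) := rfl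

end IdxApply

/-- `dm1F ∈ FP`. [folklore] -/
theorem dm1F_mem_FP : dm1F ∈ FP :=
  comp_mem_FP Plumb.divModFn_mem_FP (fanoutFn_mem_FP (comp_mem_FP HashBricks.umulFn_mem_FP
    (fanoutFn_mem_FP lamF_mem_FP (comp_mem_FP HashBricks.umulFn_mem_FP (fanoutFn_mem_FP uMF_mem_FP uBF_mem_FP))))
    idxF_mem_FP)
/-- `dm2F ∈ FP`. [folklore] -/
theorem dm2F_mem_FP : dm2F ∈ FP :=
  comp_mem_FP Plumb.divModFn_mem_FP (fanoutFn_mem_FP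
    (comp_mem_FP HashBricks.umulFn_mem_FP (fanoutFn_mem_FP uMF_mem_FP uBF_mem_FP)) (comp_mem_FP sndF_mem_FP dm1F_mem_FP))
/-- `dm3F ∈ FP`. [folklore] -/
theorem dm3F_mem_FP : dm3F ∈ FP :=
  comp_mem_FP Plumb.divModFn_mem_FP (fanoutFn_mem_FP uBF_mem_FP (comp_mem_FP sndF_mem_FP dm2F_mem_FP))
/-- `ueF ∈ FP`. [folklore] -/
theorem ueF_mem_FP : ueF ∈ FP := comp_mem_FP fstF_mem_FP dm1F_mem_FP
/-- `uqF ∈ FP`. [folklore] -/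
theorem uqF_mem_FP : uqF ∈ FP := comp_mem_FP fstF_mem_FP dm2F_mem_FP
/-- `utF ∈ FP`. [folklore] -/
theorem utF_mem_FP : utF ∈ FP := comp_mem_FP fstF_mem_FP dm3F_mem_FP
/-- `umF ∈ FP`. [folklore] -/
theorem umF_mem_FP : umF ∈ FP := comp_mem_FP sndF_mem_FP dm3F_mem_FP


/-! ### The canonical codes, structurally -/

/-- Code of a grid point. [folklore] -/
def encPt (p : GridPoint) : List Bool := encodingGridPoint.encode p
/-- Code of a point list. [folklore] -/
def encPL (π : List GridPoint) : List Bool := encodingGridPoint.listBool.encode π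
/-- Code of a drawn edge. [folklore] -/
def encDE (d : DrawnEdge) : List Bool := encodingDrawnEdge.encode d
/-- Code of an integer (sign–magnitude). [folklore] -/
def encInt (z : ℤ) : List Bool := boolPair [decide (z < 0)] (encodeNat z.natAbs)

/-- Unfolding `encInt`. [folklore] -/
theorem encInt_eq (z : ℤ) : encodingIntBool.encode z = encInt z := rfl
/-- Unfolding `encPt`. [folklore] -/
theorem encPt_eq (p : GridPoint) : encPt p = boolPair (encInt p.1) (encInt p.2) := rfl
/-- The toolkit's `encList` is the `body` of `CookReducibilityTransitive.lean` (both: nested pairs). [folklore] -/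
theorem encList_eq_body (L : List (List Bool)) : encList L = OracleCompose.body L := by
  induction L with
  | nil => rfl
  | cons a L ih => rw [encList_cons, OracleCompose.body_cons, ih]
/-- Unfolding `encPL`. [folklore] -/
theorem encPL_eq (π : List GridPoint) : encPL π = boolPair (ones π.length) (encList (π.map encPt)) := by
  rw [encPL, listBool_encode_eq_encList, OracleCompose.unaryEncodeNat_eq_replicate]; rfl
/-- Unfolding `encDE`. [folklore] -/
theorem encDE_eq (d : DrawnEdge) : encDE d = boolPair (encodeNat d.1) (boolPair (encodeNat d.2.1) (encPL d.2.2)) := rfl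
/-- Unfolding `encDG`. [folklore] -/
theorem encDG_eq (P : List GridPoint) (D : List DrawnEdge) (s t : ℕ) :
    encodingDrawnGraphInstance.encode (P, D, s, t) =
      boolPair (encPL P) (boolPair (boolPair (ones D.length) (encList (D.map encDE)))
        (boolPair (encodeNat s) (encodeNat t))) := by
  show boolPair (encPL P) (boolPair (encodingDrawnEdge.listBool.encode D)
    (boolPair (encodeNat s) (encodeNat t))) = _
  rw [listBool_encode_eq_encList encodingDrawnEdge D, OracleCompose.unaryEncodeNat_eq_replicate]; rfl

/-- Looking up an item of a coded list by a unary index. [folklore] -/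
theorem nthItemFn_encList (j : ℕ) (L : List (List Bool)) :
    HashBricks.nthItemFn (boolPair (ones j) (encList L)) = L.getD j [] := by
  rw [encList_eq_body, HashBricks.nthItemFn_body]

/-- … within range of a mapped list. [folklore] -/
theorem nthItemFn_encList_map {α : Type} (f : α → List Bool) {j : ℕ} {l : List α} (hj : j < l.length) :
    HashBricks.nthItemFn (boolPair (ones j) (encList (l.map f))) = f (l[j]) := by
  rw [nthItemFn_encList, List.getD_eq_getElem?_getD, List.getElem?_map, List.getElem?_eq_getElem hj]
  rfl

/-! ### Stage B: fetching the drawn edge `D[e]` and the points `π[q]`, `π[q+1]` -/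

/-- The code of `D` (header and items). [folklore] -/
def cDF : List Bool → List Bool := nthF 1 ∘ wF
/-- `1^{|D|}`. [folklore] -/
def hdrDF : List Bool → List Bool := fstF ∘ cDF
/-- The items of `D`. [folklore] -/
def itemsDF : List Bool → List Bool := sndF ∘ cDF
/-- The code of the drawn edge `D[e]`. [folklore] -/
def dF : List Bool → List Bool := HashBricks.nthItemFn ∘ fanoutFn ueF itemsDF
/-- The code of its path `π`. [folklore] -/
def cπF : List Bool → List Bool := sndPow 1 ∘ dF
/-- `1^{|π|}`. [folklore] -/
def hdrπF : List Bool → List Bool := fstF ∘ cπF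
/-- The items of `π`. [folklore] -/
def itemsπF : List Bool → List Bool := sndF ∘ cπF
/-- The code of `π[q]`. [folklore] -/
def paF : List Bool → List Bool := HashBricks.nthItemFn ∘ fanoutFn uqF itemsπF
/-- The code of `π[q+1]`. [folklore] -/
def pbF : List Bool → List Bool := HashBricks.nthItemFn ∘ fanoutFn (List.cons true ∘ uqF) itemsπF

/-- `cDF ∈ FP`. [folklore] -/
theorem cDF_mem_FP : cDF ∈ FP := comp_mem_FP (nthF_mem_FP 1) wF_mem_FP
/-- `hdrDF ∈ FP`. [folklore] -/
theorem hdrDF_mem_FP : hdrDF ∈ FP := comp_mem_FP fstF_mem_FP cDF_mem_FP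
/-- `itemsDF ∈ FP`. [folklore] -/
theorem itemsDF_mem_FP : itemsDF ∈ FP := comp_mem_FP sndF_mem_FP cDF_mem_FP
/-- `dF ∈ FP`. [folklore] -/
theorem dF_mem_FP : dF ∈ FP := comp_mem_FP HashBricks.nthItemFn_mem_FP (fanoutFn_mem_FP ueF_mem_FP itemsDF_mem_FP)
/-- `cπF ∈ FP`. [folklore] -/
theorem cπF_mem_FP : cπF ∈ FP := comp_mem_FP (sndPow_mem_FP 1) dF_mem_FP
/-- `hdrπF ∈ FP`. [folklore] -/
theorem hdrπF_mem_FP : hdrπF ∈ FP := comp_mem_FP fstF_mem_FP cπF_mem_FP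
/-- `itemsπF ∈ FP`. [folklore] -/
theorem itemsπF_mem_FP : itemsπF ∈ FP := comp_mem_FP sndF_mem_FP cπF_mem_FP
/-- `paF ∈ FP`. [folklore] -/
theorem paF_mem_FP : paF ∈ FP := comp_mem_FP HashBricks.nthItemFn_mem_FP (fanoutFn_mem_FP uqF_mem_FP itemsπF_mem_FP)
/-- `pbF ∈ FP`. [folklore] -/
theorem pbF_mem_FP : pbF ∈ FP :=
  comp_mem_FP HashBricks.nthItemFn_mem_FP (fanoutFn_mem_FP (comp_mem_FP (cons_mem_FP true) uqF_mem_FP) itemsπF_mem_FP)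

section FetchApply

variable (P : List GridPoint) (D : List DrawnEdge) (s t : ℕ) (Λ : ℕ) (v : GridPoint) (i : ℕ)

/-- The argument on a presentation. [folklore] -/
abbrev argOf : List Bool := arg (encodingDrawnGraphInstance.encode (P, D, s, t)) Λ v i

/-- Value of `cDF` on the piece argument of a presentation. [folklore] -/
theorem cDF_argOf : cDF (argOf P D s t Λ v i) = boolPair (ones D.length) (encList (D.map encDE)) := by
  rw [cDF, Function.comp_apply, wF_arg, encDG_eq]; simp [nthF]
/-- Value of `hdrDF` on the piece argument of a presentation. [folklore] -/
theorem hdrDF_argOf : hdrDF (argOf P D s t Λ v i) = ones D.length := by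
  rw [hdrDF, Function.comp_apply, cDF_argOf, fstF_boolPair]
/-- Value of `itemsDF` on the piece argument of a presentation. [folklore] -/
theorem itemsDF_argOf : itemsDF (argOf P D s t Λ v i) = encList (D.map encDE) := by
  rw [itemsDF, Function.comp_apply, cDF_argOf, sndF_boolPair]

variable {D Λ i}

/-- Value of `dF` on the piece argument of a presentation. [folklore] -/
theorem dF_argOf (he : idxE Λ i < D.length) : dF (argOf P D s t Λ v i) = encDE (D[idxE Λ i]) := by
  rw [dF, Function.comp_apply, fanoutFn_apply, ueF_arg, itemsDF_argOf, nthItemFn_encList_map _ he]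
/-- Value of `cπF` on the piece argument of a presentation. [folklore] -/
theorem cπF_argOf (he : idxE Λ i < D.length) : cπF (argOf P D s t Λ v i) = encPL (D[idxE Λ i]).2.2 := by
  rw [cπF, Function.comp_apply, dF_argOf P s t v he, encDE_eq]; simp [sndPow]
/-- Value of `hdrπF` on the piece argument of a presentation. [folklore] -/
theorem hdrπF_argOf (he : idxE Λ i < D.length) : hdrπF (argOf P D s t Λ v i) = ones (D[idxE Λ i]).2.2.length := by
  rw [hdrπF, Function.comp_apply, cπF_argOf P s t v he, encPL_eq, fstF_boolPair]
/-- Value of `itemsπF` on the piece argument of a presentation. [folklore] -/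
theorem itemsπF_argOf (he : idxE Λ i < D.length) :
    itemsπF (argOf P D s t Λ v i) = encList ((D[idxE Λ i]).2.2.map encPt) := by
  rw [itemsπF, Function.comp_apply, cπF_argOf P s t v he, encPL_eq, sndF_boolPair]
/-- Value of `paF` on the piece argument of a presentation. [folklore] -/
theorem paF_argOf (he : idxE Λ i < D.length) (hq : idxQ Λ i < (D[idxE Λ i]).2.2.length) :
    paF (argOf P D s t Λ v i) = encPt ((D[idxE Λ i]).2.2[idxQ Λ i]) := by
  rw [paF, Function.comp_apply, fanoutFn_apply, uqF_arg, itemsπF_argOf P s t v he, nthItemFn_encList_map _ hq]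
/-- Value of `pbF` on the piece argument of a presentation. [folklore] -/
theorem pbF_argOf (he : idxE Λ i < D.length) (hq : idxQ Λ i + 1 < (D[idxE Λ i]).2.2.length) :
    pbF (argOf P D s t Λ v i) = encPt ((D[idxE Λ i]).2.2[idxQ Λ i + 1]) := by
  rw [pbF, Function.comp_apply, fanoutFn_apply, Function.comp_apply, uqF_arg, ← Com.ones_succ,
    itemsπF_argOf P s t v he, nthItemFn_encList_map _ hq]

end FetchApply


/-! ### Stage C: the range conditions and the tower height -/

/-- `[e < |D|]`. [folklore] -/
def c1F : List Bool → List Bool := ltLenF ∘ fanoutFn ueF hdrDF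
/-- `[q + 1 < |π|]`. [folklore] -/
def c2F : List Bool → List Bool := ltLenF ∘ fanoutFn (List.cons true ∘ uqF) hdrπF
/-- `1^{Λ - λ}` (`λ = |π| - 1`). [folklore] -/
def slackF : List Bool → List Bool :=
  Plumb.dropFn ∘ fanoutFn (Plumb.dropFn ∘ fanoutFn (fun _ => [true]) hdrπF) lamF
/-- `1^{8Λ + 4(Λ - λ)}`: the end of the tower zone (`8Λ + 2T`, `T = 2(Λ - λ)`). [folklore] -/
def zoneEndF : List Bool → List Bool := fun y => u8F y ++ (onesMulFn 4 ∘ slackF) y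
/-- The tower condition `[q = 0 ∧ 8Λ ≤ t ∧ t < 8Λ + 2T ∧ 2 ∣ t - 8Λ]`. [folklore] -/
def towF : List Bool → List Bool :=
  andFn (isNilFn ∘ uqF) (andFn (notFn (ltLenF ∘ fanoutFn utF u8F))
    (andFn (ltLenF ∘ fanoutFn utF zoneEndF)
      (parityFn ∘ HashBricks.popCountFn ∘ Plumb.dropFn ∘ fanoutFn u8F utF)))
/-- `1^{h'}`: the tower height `6Λ` under a tower, `0` otherwise. [folklore] -/
def hF : List Bool → List Bool := iteFn towF u6F fun _ => []
/-- `[m ≤ 2h']`. [folklore] -/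
def c3F : List Bool → List Bool := notFn (ltLenF ∘ fanoutFn (fun y => hF y ++ hF y) umF)
/-- The conjunction of the three range conditions. [folklore] -/
def rangeF : List Bool → List Bool := andFn c1F (andFn c2F c3F)

/-- `c1F ∈ FP`. [folklore] -/
theorem c1F_mem_FP : c1F ∈ FP := comp_mem_FP ltLenF_mem_FP (fanoutFn_mem_FP ueF_mem_FP hdrDF_mem_FP)
/-- `c2F ∈ FP`. [folklore] -/
theorem c2F_mem_FP : c2F ∈ FP :=
  comp_mem_FP ltLenF_mem_FP (fanoutFn_mem_FP (comp_mem_FP (cons_mem_FP true) uqF_mem_FP) hdrπF_mem_FP)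
/-- `slackF ∈ FP`. [folklore] -/
theorem slackF_mem_FP : slackF ∈ FP :=
  comp_mem_FP Plumb.dropFn_mem_FP (fanoutFn_mem_FP
    (comp_mem_FP Plumb.dropFn_mem_FP (fanoutFn_mem_FP (const_mem_FP _) hdrπF_mem_FP)) lamF_mem_FP)
/-- `zoneEndF ∈ FP`. [folklore] -/
theorem zoneEndF_mem_FP : zoneEndF ∈ FP :=
  append_mem_FP u8F_mem_FP (comp_mem_FP (onesMulFn_mem_FP 4) slackF_mem_FP)
/-- `towF ∈ FP`. [folklore] -/
theorem towF_mem_FP : towF ∈ FP :=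
  andFn_mem_FP (comp_mem_FP isNilFn_mem_FP uqF_mem_FP) (andFn_mem_FP
    (notFn_mem_FP (comp_mem_FP ltLenF_mem_FP (fanoutFn_mem_FP utF_mem_FP u8F_mem_FP)))
    (andFn_mem_FP (comp_mem_FP ltLenF_mem_FP (fanoutFn_mem_FP utF_mem_FP zoneEndF_mem_FP))
      (comp_mem_FP parityFn_mem_FP (comp_mem_FP HashBricks.popCountFn_mem_FP
        (comp_mem_FP Plumb.dropFn_mem_FP (fanoutFn_mem_FP u8F_mem_FP utF_mem_FP))))))
/-- `hF ∈ FP`. [folklore] -/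
theorem hF_mem_FP : hF ∈ FP := iteFn_mem_FP towF_mem_FP u6F_mem_FP (const_mem_FP _)
/-- `c3F ∈ FP`. [folklore] -/
theorem c3F_mem_FP : c3F ∈ FP :=
  notFn_mem_FP (comp_mem_FP ltLenF_mem_FP (fanoutFn_mem_FP (append_mem_FP hF_mem_FP hF_mem_FP) umF_mem_FP))
/-- `rangeF ∈ FP`. [folklore] -/
theorem rangeF_mem_FP : rangeF ∈ FP := andFn_mem_FP c1F_mem_FP (andFn_mem_FP c2F_mem_FP c3F_mem_FP)

/-- `towF` is one-bit. [folklore] -/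
theorem oneBit_towF : OneBit towF := oneBit_andFn (oneBit_isNilFn.comp _) (oneBit_andFn (oneBit_notFn
  (oneBit_ltLenF.comp _)) (oneBit_andFn (oneBit_ltLenF.comp _) (oneBit_parityFn.comp _)))
/-- `c2F` is one-bit. [folklore] -/
theorem oneBit_c2F : OneBit c2F := oneBit_ltLenF.comp _
/-- `c3F` is one-bit. [folklore] -/
theorem oneBit_c3F : OneBit c3F := oneBit_notFn (oneBit_ltLenF.comp _)
/-- `rangeF` is one-bit. [folklore] -/
theorem oneBit_rangeF : OneBit rangeF :=
  oneBit_andFn (oneBit_ltLenF.comp _) (oneBit_andFn oneBit_c2F oneBit_c3F)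

/-- **The tower height at a position**, semantically: `6Λ` if segment `0` and `t` is a tower
offset of the drawn edge, else `0`. [folklore] -/
def hgt (Λ : ℕ) (d : DrawnEdge) (q t : ℕ) : ℕ :=
  if q = 0 ∧ t ∈ towerOffsets Λ (towerCount Λ d) then 6 * Λ else 0

section CondApply

variable (P : List GridPoint) {D : List DrawnEdge} (s t : ℕ) {Λ : ℕ} (v : GridPoint) {i : ℕ}

/-- Value of `c1F` on the piece argument of a presentation. [folklore] -/
theorem c1F_argOf (D : List DrawnEdge) (Λ i : ℕ) :
    c1F (argOf P D s t Λ v i) = [decide (idxE Λ i < D.length)] := by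
  rw [c1F, Function.comp_apply, fanoutFn_apply, ueF_arg, hdrDF_argOf, ltLenF_ones]

/-- Value of `c2F` on the piece argument of a presentation. [folklore] -/
theorem c2F_argOf (he : idxE Λ i < D.length) :
    c2F (argOf P D s t Λ v i) = [decide (idxQ Λ i + 1 < (D[idxE Λ i]).2.2.length)] := by
  rw [c2F, Function.comp_apply, fanoutFn_apply, Function.comp_apply, uqF_arg, ← Com.ones_succ,
    hdrπF_argOf P s t v he, ltLenF_ones]

/-- Value of `slackF` on the piece argument of a presentation. [folklore] -/
theorem slackF_argOf (he : idxE Λ i < D.length) :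
    slackF (argOf P D s t Λ v i) = ones (Λ - ((D[idxE Λ i]).2.2.length - 1)) := by
  rw [slackF, Function.comp_apply, fanoutFn_apply, Function.comp_apply, fanoutFn_apply,
    hdrπF_argOf P s t v he, lamF_arg, show [true] = ones 1 from rfl, dropFn_boolPair_ones,
    dropFn_boolPair_ones]

/-- Value of `towF` on the piece argument of a presentation. [folklore] -/
theorem towF_argOf (he : idxE Λ i < D.length) :
    towF (argOf P D s t Λ v i) =
      [decide (idxQ Λ i = 0 ∧ idxT Λ i ∈ towerOffsets Λ (towerCount Λ (D[idxE Λ i])))] := by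
  have h1 : (isNilFn ∘ uqF) (argOf P D s t Λ v i) = [decide (idxQ Λ i = 0)] := by
    rw [Function.comp_apply, uqF_arg]; simp [isNilFn, ones, List.replicate_eq_nil_iff]
  have h2 : (ltLenF ∘ fanoutFn utF u8F) (argOf P D s t Λ v i) = [decide (idxT Λ i < 8 * Λ)] := by
    rw [Function.comp_apply, fanoutFn_apply, utF_arg, u8F_arg, ltLenF_ones]
  have h3 : (ltLenF ∘ fanoutFn utF zoneEndF) (argOf P D s t Λ v i) =
      [decide (idxT Λ i < 8 * Λ + 4 * (Λ - ((D[idxE Λ i]).2.2.length - 1)))] := by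
    rw [Function.comp_apply, fanoutFn_apply, utF_arg, zoneEndF, u8F_arg, Function.comp_apply,
      slackF_argOf P s t v he, onesMulFn_ones, Com.ones_append, ltLenF_ones]
  have h4 : (parityFn ∘ HashBricks.popCountFn ∘ Plumb.dropFn ∘ fanoutFn u8F utF) (argOf P D s t Λ v i) =
      [decide (Even (idxT Λ i - 8 * Λ))] := by
    simp only [Function.comp_apply, fanoutFn_apply, u8F_arg, utF_arg, dropFn_boolPair_ones, popCountFn_ones,
      parityFn_encodeNat]
  rw [towF, andFn_apply h1 (andFn_apply (notFn_apply h2) (andFn_apply h3 h4))]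
  congr 1
  rw [Bool.eq_iff_iff]
  simp only [Bool.and_eq_true, decide_eq_true_eq, Bool.not_eq_true', decide_eq_false_iff_not, not_lt,
    Nat.even_iff, mem_towerOffsets_iff, towerCount]
  omega

/-- Value of `hF` on the piece argument of a presentation. [folklore] -/
theorem hF_argOf (he : idxE Λ i < D.length) :
    hF (argOf P D s t Λ v i) = ones (hgt Λ (D[idxE Λ i]) (idxQ Λ i) (idxT Λ i)) := by
  rw [hF, iteFn_apply (towF_argOf P s t v he), hgt]
  by_cases hc : idxQ Λ i = 0 ∧ idxT Λ i ∈ towerOffsets Λ (towerCount Λ (D[idxE Λ i]))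
  · simp only [hc, and_self, decide_true, ↓reduceIte]
    exact u6F_arg _ _ _ _
  · simp only [hc, decide_false, ↓reduceIte]
    rfl

/-- Value of `c3F` on the piece argument of a presentation. [folklore] -/
theorem c3F_argOf (he : idxE Λ i < D.length) :
    c3F (argOf P D s t Λ v i) = [decide (idxM Λ i ≤ 2 * hgt Λ (D[idxE Λ i]) (idxQ Λ i) (idxT Λ i))] := by
  have h : (ltLenF ∘ fanoutFn (fun y => hF y ++ hF y) umF) (argOf P D s t Λ v i) =
      [decide (2 * hgt Λ (D[idxE Λ i]) (idxQ Λ i) (idxT Λ i) < idxM Λ i)] := by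
    rw [Function.comp_apply, fanoutFn_apply, hF_argOf P s t v he, umF_arg, Com.ones_append, ← two_mul, ltLenF_ones]
  rw [c3F, notFn_apply h]
  congr 1
  rw [Bool.eq_iff_iff]
  simp

/-- **The range condition decides whether the piece is empty**: it holds iff `e < |D|`,
`q + 1 < |π_e|` and `m ≤ 2h'`. [folklore] -/
theorem rangeF_argOf_eq_true_iff (D : List DrawnEdge) (Λ i : ℕ) :
    rangeF (argOf P D s t Λ v i) = [true] ↔
      ∃ he : idxE Λ i < D.length, idxQ Λ i + 1 < (D[idxE Λ i]).2.2.length ∧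
        idxM Λ i ≤ 2 * hgt Λ (D[idxE Λ i]) (idxQ Λ i) (idxT Λ i) := by
  by_cases he : idxE Λ i < D.length
  · rw [rangeF, andFn_apply (c1F_argOf P s t v D Λ i) (andFn_apply (c2F_argOf P s t v he) (c3F_argOf P s t v he))]
    simp [he]
  · obtain ⟨b₂, hb₂⟩ := oneBit_c2F (argOf P D s t Λ v i)
    obtain ⟨b₃, hb₃⟩ := oneBit_c3F (argOf P D s t Λ v i)
    rw [rangeF, andFn_apply (c1F_argOf P s t v D Λ i) (andFn_apply hb₂ hb₃)]
    simp [he]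

end CondApply


/-! ### Stage D: the two end points of the unit edge, as translated point codes -/

section Coords

variable (jF : List Bool → List Bool)

/-- `[j ≤ h']` for the unary `j` computed by `jF`. [folklore] -/
def jleF : List Bool → List Bool := notFn (ltLenF ∘ fanoutFn hF jF)
/-- `1ᶜ`: the column, `t` on the way up (`j ≤ h'`), `t + 1` on the way down. [folklore] -/
def ucF : List Bool → List Bool := iteFn (jleF jF) utF (List.cons true ∘ utF)
/-- `1ᵏ`: the height, `j` on the way up, `2h' + 1 - j` on the way down. [folklore] -/
def ukF : List Bool → List Bool :=
  iteFn (jleF jF) jF (Plumb.dropFn ∘ fanoutFn jF (List.cons true ∘ fun y => hF y ++ hF y))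
/-- `dpEnc M`. [folklore] -/
def zMF : List Bool → List Bool := natZF ∘ uMF
/-- `dpEnc a.1` (`a = π[q]`). [folklore] -/
def a1F : List Bool → List Bool := ofSMFn ∘ fstF ∘ paF
/-- `dpEnc a.2`. [folklore] -/
def a2F : List Bool → List Bool := ofSMFn ∘ sndF ∘ paF
/-- `dpEnc u.1` (`u = π[q+1] - π[q]`). [folklore] -/
def u1F : List Bool → List Bool := zsubF ∘ fanoutFn (ofSMFn ∘ fstF ∘ pbF) a1F
/-- `dpEnc u.2`. [folklore] -/
def u2F : List Bool → List Bool := zsubF ∘ fanoutFn (ofSMFn ∘ sndF ∘ pbF) a2F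
/-- `dpEnc (M a.1 + c u.1 - k u.2 + v.1)`: first coordinate of the translated tower point. [folklore] -/
def x1F : List Bool → List Bool :=
  zaddF ∘ fanoutFn (zsubF ∘ fanoutFn (zaddF ∘ fanoutFn (zmulF ∘ fanoutFn zMF a1F)
    (zmulF ∘ fanoutFn (natZF ∘ ucF jF) u1F)) (zmulF ∘ fanoutFn (natZF ∘ ukF jF) u2F)) v1F
/-- `dpEnc (M a.2 + c u.2 + k u.1 + v.2)`: second coordinate. [folklore] -/
def x2F : List Bool → List Bool :=
  zaddF ∘ fanoutFn (zaddF ∘ fanoutFn (zaddF ∘ fanoutFn (zmulF ∘ fanoutFn zMF a2F)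
    (zmulF ∘ fanoutFn (natZF ∘ ucF jF) u2F)) (zmulF ∘ fanoutFn (natZF ∘ ukF jF) u1F)) v2F
/-- The sign–magnitude code of the translated tower point. [folklore] -/
def ptF : List Bool → List Bool := fanoutFn (signMagOfZF ∘ x1F jF) (signMagOfZF ∘ x2F jF)

variable {jF}

/-- `jleF ∈ FP`. [folklore] -/
theorem jleF_mem_FP (h : jF ∈ FP) : jleF jF ∈ FP := notFn_mem_FP (comp_mem_FP ltLenF_mem_FP (fanoutFn_mem_FP hF_mem_FP h))
/-- `ucF ∈ FP`. [folklore] -/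
theorem ucF_mem_FP (h : jF ∈ FP) : ucF jF ∈ FP :=
  iteFn_mem_FP (jleF_mem_FP h) utF_mem_FP (comp_mem_FP (cons_mem_FP true) utF_mem_FP)
/-- `ukF ∈ FP`. [folklore] -/
theorem ukF_mem_FP (h : jF ∈ FP) : ukF jF ∈ FP :=
  iteFn_mem_FP (jleF_mem_FP h) h (comp_mem_FP Plumb.dropFn_mem_FP (fanoutFn_mem_FP h
    (comp_mem_FP (cons_mem_FP true) (append_mem_FP hF_mem_FP hF_mem_FP))))
/-- `zMF ∈ FP`. [folklore] -/
theorem zMF_mem_FP : zMF ∈ FP := comp_mem_FP natZF_mem_FP uMF_mem_FP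
/-- `a1F ∈ FP`. [folklore] -/
theorem a1F_mem_FP : a1F ∈ FP := comp_mem_FP ofSMFn_mem_FP (comp_mem_FP fstF_mem_FP paF_mem_FP)
/-- `a2F ∈ FP`. [folklore] -/
theorem a2F_mem_FP : a2F ∈ FP := comp_mem_FP ofSMFn_mem_FP (comp_mem_FP sndF_mem_FP paF_mem_FP)
/-- `u1F ∈ FP`. [folklore] -/
theorem u1F_mem_FP : u1F ∈ FP :=
  comp_mem_FP zsubF_mem_FP (fanoutFn_mem_FP (comp_mem_FP ofSMFn_mem_FP (comp_mem_FP fstF_mem_FP pbF_mem_FP)) a1F_mem_FP)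
/-- `u2F ∈ FP`. [folklore] -/
theorem u2F_mem_FP : u2F ∈ FP :=
  comp_mem_FP zsubF_mem_FP (fanoutFn_mem_FP (comp_mem_FP ofSMFn_mem_FP (comp_mem_FP sndF_mem_FP pbF_mem_FP)) a2F_mem_FP)
/-- `x1F ∈ FP`. [folklore] -/
theorem x1F_mem_FP (h : jF ∈ FP) : x1F jF ∈ FP :=
  comp_mem_FP zaddF_mem_FP (fanoutFn_mem_FP (comp_mem_FP zsubF_mem_FP (fanoutFn_mem_FP
    (comp_mem_FP zaddF_mem_FP (fanoutFn_mem_FP (comp_mem_FP zmulF_mem_FP (fanoutFn_mem_FP zMF_mem_FP a1F_mem_FP))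
      (comp_mem_FP zmulF_mem_FP (fanoutFn_mem_FP (comp_mem_FP natZF_mem_FP (ucF_mem_FP h)) u1F_mem_FP))))
    (comp_mem_FP zmulF_mem_FP (fanoutFn_mem_FP (comp_mem_FP natZF_mem_FP (ukF_mem_FP h)) u2F_mem_FP)))) v1F_mem_FP)
/-- `x2F ∈ FP`. [folklore] -/
theorem x2F_mem_FP (h : jF ∈ FP) : x2F jF ∈ FP :=
  comp_mem_FP zaddF_mem_FP (fanoutFn_mem_FP (comp_mem_FP zaddF_mem_FP (fanoutFn_mem_FP
    (comp_mem_FP zaddF_mem_FP (fanoutFn_mem_FP (comp_mem_FP zmulF_mem_FP (fanoutFn_mem_FP zMF_mem_FP a2F_mem_FP))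
      (comp_mem_FP zmulF_mem_FP (fanoutFn_mem_FP (comp_mem_FP natZF_mem_FP (ucF_mem_FP h)) u2F_mem_FP))))
    (comp_mem_FP zmulF_mem_FP (fanoutFn_mem_FP (comp_mem_FP natZF_mem_FP (ukF_mem_FP h)) u1F_mem_FP)))) v2F_mem_FP)
/-- `ptF ∈ FP`. [folklore] -/
theorem ptF_mem_FP (h : jF ∈ FP) : ptF jF ∈ FP :=
  fanoutFn_mem_FP (comp_mem_FP signMagOfZF_mem_FP (x1F_mem_FP h)) (comp_mem_FP signMagOfZF_mem_FP (x2F_mem_FP h))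

end Coords

/-- **The point of a block at height index `j`**, semantically (base `π[q]`, direction
`π[q+1] - π[q]`, tower height `hgt`). [folklore] -/
def blockPt (Λ : ℕ) (d : DrawnEdge) (q t j : ℕ) : GridPoint :=
  towerBlockPt (bigM Λ) (d.2.2.getD q 0) (d.2.2.getD (q + 1) 0 - d.2.2.getD q 0) t (hgt Λ d q t) j

section CoordsApply

variable (P : List GridPoint) {D : List DrawnEdge} (s t : ℕ) {Λ : ℕ} (v : GridPoint) {i : ℕ}
  {jF : List Bool → List Bool} {j : ℕ}

/-- `ofSMFn` reads the sign–magnitude code of an integer as its difference pair. [folklore] -/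
theorem ofSMFn_encInt (z : ℤ) : ofSMFn (encInt z) = dpEnc z := ofSMFn_encode z
/-- `signMagOfZF` writes a difference pair back as the sign–magnitude code. [folklore] -/
theorem signMagOfZF_dpEnc' (z : ℤ) : signMagOfZF (dpEnc z) = encInt z := signMagOfZF_dpEnc z

/-- Value of `jleF` on the piece argument of a presentation. [folklore] -/
theorem jleF_argOf (he : idxE Λ i < D.length) (hj : jF (argOf P D s t Λ v i) = ones j) :
    jleF jF (argOf P D s t Λ v i) = [decide (j ≤ hgt Λ (D[idxE Λ i]) (idxQ Λ i) (idxT Λ i))] := by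
  have h : (ltLenF ∘ fanoutFn hF jF) (argOf P D s t Λ v i) =
      [decide (hgt Λ (D[idxE Λ i]) (idxQ Λ i) (idxT Λ i) < j)] := by
    rw [Function.comp_apply, fanoutFn_apply, hF_argOf P s t v he, hj, ltLenF_ones]
  rw [jleF, notFn_apply h]
  congr 1; rw [Bool.eq_iff_iff]; simp

/-- Value of `ucF` on the piece argument of a presentation. [folklore] -/
theorem ucF_argOf (he : idxE Λ i < D.length) (hj : jF (argOf P D s t Λ v i) = ones j) :
    ucF jF (argOf P D s t Λ v i) =
      ones (if j ≤ hgt Λ (D[idxE Λ i]) (idxQ Λ i) (idxT Λ i) then idxT Λ i else idxT Λ i + 1) := by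
  rw [ucF, iteFn_apply (jleF_argOf P s t v he hj)]
  by_cases h : j ≤ hgt Λ (D[idxE Λ i]) (idxQ Λ i) (idxT Λ i)
  · simp only [h, decide_true, ↓reduceIte]
    exact utF_arg _ _ _ _
  · simp only [h, decide_false, Bool.false_eq_true, ↓reduceIte, Function.comp_apply]
    rw [utF_arg, ← Com.ones_succ]

/-- Value of `ukF` on the piece argument of a presentation. [folklore] -/
theorem ukF_argOf (he : idxE Λ i < D.length) (hj : jF (argOf P D s t Λ v i) = ones j) :
    ukF jF (argOf P D s t Λ v i) =
      ones (if j ≤ hgt Λ (D[idxE Λ i]) (idxQ Λ i) (idxT Λ i) then j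
        else 2 * hgt Λ (D[idxE Λ i]) (idxQ Λ i) (idxT Λ i) + 1 - j) := by
  rw [ukF, iteFn_apply (jleF_argOf P s t v he hj)]
  by_cases h : j ≤ hgt Λ (D[idxE Λ i]) (idxQ Λ i) (idxT Λ i)
  · simp only [h, decide_true, ↓reduceIte]
    exact hj
  · simp only [h, decide_false, Bool.false_eq_true, ↓reduceIte, Function.comp_apply, fanoutFn_apply]
    rw [hj, hF_argOf P s t v he, Com.ones_append, ← Com.ones_succ, dropFn_boolPair_ones, ← two_mul]

/-- Value of `zMF` on the piece argument of a presentation. [folklore] -/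
theorem zMF_arg (w : List Bool) (Λ : ℕ) (v : GridPoint) (i : ℕ) : zMF (arg w Λ v i) = dpEnc (bigM Λ) := by
  rw [zMF, Function.comp_apply, uMF_arg, natZF_ones]

/-- Value of `a1F` on the piece argument of a presentation. [folklore] -/
theorem a1F_argOf (he : idxE Λ i < D.length) (hq : idxQ Λ i < (D[idxE Λ i]).2.2.length) :
    a1F (argOf P D s t Λ v i) = dpEnc ((D[idxE Λ i]).2.2[idxQ Λ i]).1 := by
  rw [a1F, Function.comp_apply, Function.comp_apply, paF_argOf P s t v he hq, encPt_eq, fstF_boolPair, ofSMFn_encInt]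
/-- Value of `a2F` on the piece argument of a presentation. [folklore] -/
theorem a2F_argOf (he : idxE Λ i < D.length) (hq : idxQ Λ i < (D[idxE Λ i]).2.2.length) :
    a2F (argOf P D s t Λ v i) = dpEnc ((D[idxE Λ i]).2.2[idxQ Λ i]).2 := by
  rw [a2F, Function.comp_apply, Function.comp_apply, paF_argOf P s t v he hq, encPt_eq, sndF_boolPair, ofSMFn_encInt]
/-- Value of `u1F` on the piece argument of a presentation. [folklore] -/
theorem u1F_argOf (he : idxE Λ i < D.length) (hq : idxQ Λ i + 1 < (D[idxE Λ i]).2.2.length) :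
    u1F (argOf P D s t Λ v i) = dpEnc (((D[idxE Λ i]).2.2[idxQ Λ i + 1]).1 - ((D[idxE Λ i]).2.2[idxQ Λ i]).1) := by
  rw [u1F, Function.comp_apply, fanoutFn_apply, Function.comp_apply, Function.comp_apply,
    pbF_argOf P s t v he hq, encPt_eq, fstF_boolPair, ofSMFn_encInt, a1F_argOf P s t v he (by omega),
    zsubF_boolPair, ival_dpEnc, ival_dpEnc]
/-- Value of `u2F` on the piece argument of a presentation. [folklore] -/
theorem u2F_argOf (he : idxE Λ i < D.length) (hq : idxQ Λ i + 1 < (D[idxE Λ i]).2.2.length) :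
    u2F (argOf P D s t Λ v i) = dpEnc (((D[idxE Λ i]).2.2[idxQ Λ i + 1]).2 - ((D[idxE Λ i]).2.2[idxQ Λ i]).2) := by
  rw [u2F, Function.comp_apply, fanoutFn_apply, Function.comp_apply, Function.comp_apply,
    pbF_argOf P s t v he hq, encPt_eq, sndF_boolPair, ofSMFn_encInt, a2F_argOf P s t v he (by omega),
    zsubF_boolPair, ival_dpEnc, ival_dpEnc]

/-- **The point code computed by `ptF`** is the code of the translated `j`-th point of the block.
[folklore] -/
theorem ptF_argOf (he : idxE Λ i < D.length) (hq : idxQ Λ i + 1 < (D[idxE Λ i]).2.2.length)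
    (hj : jF (argOf P D s t Λ v i) = ones j) :
    ptF jF (argOf P D s t Λ v i) = encPt (blockPt Λ (D[idxE Λ i]) (idxQ Λ i) (idxT Λ i) j + v) := by
  have hq' : idxQ Λ i < (D[idxE Λ i]).2.2.length := by omega
  have e1 : (D[idxE Λ i]).2.2.getD (idxQ Λ i) 0 = (D[idxE Λ i]).2.2[idxQ Λ i] := List.getD_eq_getElem _ _ hq'
  have e2 : (D[idxE Λ i]).2.2.getD (idxQ Λ i + 1) 0 = (D[idxE Λ i]).2.2[idxQ Λ i + 1] := List.getD_eq_getElem _ _ hq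
  simp only [ptF, x1F, x2F, fanoutFn_apply, Function.comp_apply, zMF_arg, a1F_argOf P s t v he hq',
    a2F_argOf P s t v he hq', u1F_argOf P s t v he hq, u2F_argOf P s t v he hq, ucF_argOf P s t v he hj,
    ukF_argOf P s t v he hj, natZF_ones, v1F_arg, v2F_arg, zmulF_boolPair, zaddF_boolPair, zsubF_boolPair,
    ival_dpEnc, signMagOfZF_dpEnc', encPt_eq, blockPt, towerBlockPt, e1, e2, Prod.fst_add, Prod.snd_add]
  split_ifs with h <;> simp only [towerPt_fst, towerPt_snd, Prod.fst_sub, Prod.snd_sub]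

end CoordsApply


/-! ### The piece function -/

/-- **The item coder of the translated edge list**: the `encodingGridPoint.pairBool`-code of the
unit edge moved by `v`. [folklore] -/
def cV (v : GridPoint) (XY : GridPoint × GridPoint) : List Bool :=
  (encodingGridPoint.pairBool encodingGridPoint).encode (XY.1 + v, XY.2 + v)

/-- Unfolding `cV`. [folklore] -/
theorem cV_eq (v : GridPoint) (XY : GridPoint × GridPoint) :
    cV v XY = boolPair (encPt (XY.1 + v)) (encPt (XY.2 + v)) := rfl

/-- The code of the unit edge at the position: its two translated end points. [folklore] -/
def edgeF : List Bool → List Bool := fanoutFn (ptF umF) (ptF (List.cons true ∘ umF))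

/-- **The piece function of the generator**: the frame `⟨edge code, ε⟩` (= `dbl (code) ++ 01`)
of the unit edge at position `i`, or nothing out of range.
[cite: LiskiewiczOgiharaToda2003, §4 (proof of Theorem 7: R₁ emits E₂)] -/
def pieceFn : List Bool → List Bool := iteFn rangeF (fanoutFn edgeF fun _ => []) fun _ => []

/-- `edgeF ∈ FP`. [folklore] -/
theorem edgeF_mem_FP : edgeF ∈ FP :=
  fanoutFn_mem_FP (ptF_mem_FP umF_mem_FP) (ptF_mem_FP (comp_mem_FP (cons_mem_FP true) umF_mem_FP))

/-- **`pieceFn ∈ FP`.** [cite: AroraBarak2009, §1.3 (closure of polynomial time under composition)] -/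
theorem pieceFn_mem_FP : pieceFn ∈ FP :=
  iteFn_mem_FP rangeF_mem_FP (fanoutFn_mem_FP edgeF_mem_FP (const_mem_FP _)) (const_mem_FP _)

/-- The tower height of `getElem?_blockEdges` for a segment is `hgt`. [folklore] -/
theorem hgt_eq (Λ : ℕ) (d : DrawnEdge) (q t : ℕ) :
    (if t ∈ (if q = 0 then towerOffsets Λ (towerCount Λ d) else []) then (if q = 0 then 6 * Λ else 1) else 0) =
      hgt Λ d q t := by
  unfold hgt
  by_cases hq : q = 0
  · simp [hq]
  · simp [hq]

/-- The flat piece in closed form, in range. [folklore] -/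
theorem pieceAt_of_range {Λ : ℕ} {D : List DrawnEdge} (c : GridPoint × GridPoint → List Bool) {e q t m : ℕ}
    (he : e < D.length) (hq : q + 1 < (D[e]).2.2.length) (hm : m ≤ 2 * hgt Λ (D[e]) q t) :
    pieceAt Λ D c e q t m = boolPair (c (blockPt Λ (D[e]) q t m, blockPt Λ (D[e]) q t (m + 1))) [] := by
  rw [pieceAt, List.getElem?_eq_getElem he]
  simp only [hq, ↓reduceIte]
  rw [segBlock, getElem?_blockEdges, hgt_eq, if_pos hm]
  simp only [boolPair_eq, List.append_nil]
  rfl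

/-- The flat piece out of range is empty. [folklore] -/
theorem pieceAt_of_not_range {Λ : ℕ} {D : List DrawnEdge} (c : GridPoint × GridPoint → List Bool) {e q t m : ℕ}
    (h : ¬ ∃ he : e < D.length, q + 1 < (D[e]).2.2.length ∧ m ≤ 2 * hgt Λ (D[e]) q t) :
    pieceAt Λ D c e q t m = [] := by
  rw [pieceAt]
  by_cases he : e < D.length
  · rw [List.getElem?_eq_getElem he]
    simp only
    by_cases hq : q + 1 < (D[e]).2.2.length
    · rw [if_pos hq, segBlock, getElem?_blockEdges, hgt_eq, if_neg (fun hm => h ⟨he, hq, hm⟩)]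
    · rw [if_neg hq]
  · rw [List.getElem?_eq_none (not_lt.mp he)]

/-- **The piece function computes the flat pieces.** On the argument `⟨ctx, 1ⁱ⟩` of a
presentation `(P, D, s, t)` (canonical code), with `Λ` and the translation `v` in the context,
`pieceFn` returns `pieceFlat Λ D (cV v) i` — for every `i`.
[cite: LiskiewiczOgiharaToda2003, §4 (proof of Theorem 7, E₂)] -/
theorem pieceFn_argOf (P : List GridPoint) (D : List DrawnEdge) (s t Λ : ℕ) (v : GridPoint) (i : ℕ) :
    pieceFn (argOf P D s t Λ v i) = pieceFlat Λ D (cV v) i := by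
  rw [pieceFn, iteFn_of_oneBit oneBit_rangeF, pieceFlat_eq]
  by_cases hr : rangeF (argOf P D s t Λ v i) = [true]
  · obtain ⟨he, hq, hm⟩ := (rangeF_argOf_eq_true_iff P s t v D Λ i).mp hr
    rw [if_pos hr, pieceAt_of_range _ he hq hm, fanoutFn_apply, edgeF, fanoutFn_apply,
      ptF_argOf P s t v he hq (umF_arg _ _ _ _),
      ptF_argOf P s t v he hq (j := idxM Λ i + 1) (by rw [Function.comp_apply, umF_arg, ← Com.ones_succ]), cV_eq]
  · rw [if_neg hr, pieceAt_of_not_range _ (fun h => hr ((rangeF_argOf_eq_true_iff P s t v D Λ i).mpr h))]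


/-! ### The size of the pieces on the generator's own trajectory -/

/-- An item of a coded list is shorter than the code. [folklore] -/
theorem length_le_of_mem_encList {c : List Bool} : ∀ {L : List (List Bool)}, c ∈ L → 2 * c.length + 2 ≤ (encList L).length
  | [], h => by simp at h
  | a :: L, h => by
    rw [encList_cons, length_boolPair]
    rcases List.mem_cons.mp h with rfl | h
    · omega
    · have := length_le_of_mem_encList h; omega

/-- The code of a point of a drawn path is a part of the presentation code. [folklore] -/
theorem length_encPt_le (P : List GridPoint) {D : List DrawnEdge} (s t : ℕ) {d : DrawnEdge} (hd : d ∈ D)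
    {p : GridPoint} (hp : p ∈ d.2.2) :
    (encPt p).length ≤ (encodingDrawnGraphInstance.encode (P, D, s, t)).length := by
  have h1 : 2 * (encPt p).length + 2 ≤ (encList (d.2.2.map encPt)).length :=
    length_le_of_mem_encList (List.mem_map.mpr ⟨p, hp, rfl⟩)
  have h2 : (encList (d.2.2.map encPt)).length ≤ (encDE d).length := by
    rw [encDE_eq, encPL_eq, length_boolPair, length_boolPair, length_boolPair]; omega
  have h3 : 2 * (encDE d).length + 2 ≤ (encList (D.map encDE)).length :=
    length_le_of_mem_encList (List.mem_map.mpr ⟨d, hd, rfl⟩)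
  rw [encDG_eq, length_boolPair, length_boolPair, length_boolPair]
  omega

/-- The binary size of a coordinate is below the length of the point code. [folklore] -/
theorem size_natAbs_le_length_encPt (p : GridPoint) :
    p.1.natAbs.size ≤ (encPt p).length ∧ p.2.natAbs.size ≤ (encPt p).length := by
  rw [encPt_eq, length_boolPair, encInt, encInt, length_boolPair, length_boolPair,
    ← TM2Pass.length_encodeNat_eq_size, ← TM2Pass.length_encodeNat_eq_size]
  simp only [List.length_singleton]
  omega

/-- The binary size of an integer is below the length of its difference-pair code. [folklore] -/
theorem size_natAbs_le_length_dpEnc (z : ℤ) : z.natAbs.size ≤ (dpEnc z).length := by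
  rw [← TM2Pass.length_encodeNat_eq_size, ← zlen_dpEnc]; exact zlen_le_length _

/-- `M = 24Λ < 2^{Λ + 5}`. [folklore] -/
theorem bigM_lt_two_pow (Λ : ℕ) : bigM Λ < 2 ^ (Λ + 5) := by
  have h := Nat.lt_two_pow_self (n := Λ)
  unfold bigM
  calc 24 * Λ < 32 * 2 ^ Λ := by omega
    _ = 2 ^ (Λ + 5) := by rw [pow_add]; norm_num; ring

/-- The length of the code of a point whose coordinates have bounded size. [folklore] -/
theorem length_encPt_le_of_size {p : GridPoint} {n : ℕ} (h1 : p.1.natAbs.size ≤ n) (h2 : p.2.natAbs.size ≤ n) :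
    (encPt p).length ≤ 3 * n + 14 := by
  rw [encPt_eq, length_boolPair, encInt, encInt, length_boolPair, length_boolPair,
    TM2Pass.length_encodeNat_eq_size, TM2Pass.length_encodeNat_eq_size]
  simp only [List.length_singleton]
  omega

/-- A coordinate of a translated tower point: `|M a + c u - k u' + v| ≤ M (|a| + 2) + |v|` for unit
components and `c, k ≤ M`. [folklore] -/
theorem natAbs_coord_le {M : ℕ} {a u u' v : ℤ} {c k : ℕ} (hc : c ≤ M) (hk : k ≤ M) (hu : u.natAbs ≤ 1)
    (hu' : u'.natAbs ≤ 1) : ((M : ℤ) * a + c * u - k * u' + v).natAbs ≤ M * (a.natAbs + 2) + v.natAbs ∧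
      ((M : ℤ) * a + c * u + k * u' + v).natAbs ≤ M * (a.natAbs + 2) + v.natAbs := by
  have e1 : ((M : ℤ) * a).natAbs = M * a.natAbs := by rw [Int.natAbs_mul]; simp
  have e2 : ((c : ℤ) * u).natAbs ≤ M := by
    rw [Int.natAbs_mul, Int.natAbs_natCast]; exact (Nat.mul_le_mul hc hu).trans (by omega)
  have e3 : ((k : ℤ) * u').natAbs ≤ M := by
    rw [Int.natAbs_mul, Int.natAbs_natCast]; exact (Nat.mul_le_mul hk hu').trans (by omega)
  constructor
  · calc ((M : ℤ) * a + c * u - k * u' + v).natAbs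
        ≤ ((M : ℤ) * a + c * u - k * u').natAbs + v.natAbs := Int.natAbs_add_le _ _
      _ ≤ (((M : ℤ) * a + c * u).natAbs + ((k : ℤ) * u').natAbs) + v.natAbs := by
          gcongr; exact Int.natAbs_sub_le _ _
      _ ≤ ((((M : ℤ) * a).natAbs + ((c : ℤ) * u).natAbs) + ((k : ℤ) * u').natAbs) + v.natAbs := by
          gcongr; exact Int.natAbs_add_le _ _
      _ ≤ M * (a.natAbs + 2) + v.natAbs := by rw [e1]; nlinarith
  · calc ((M : ℤ) * a + c * u + k * u' + v).natAbs
        ≤ ((M : ℤ) * a + c * u + k * u').natAbs + v.natAbs := Int.natAbs_add_le _ _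
      _ ≤ (((M : ℤ) * a + c * u).natAbs + ((k : ℤ) * u').natAbs) + v.natAbs := by
          gcongr; exact Int.natAbs_add_le _ _
      _ ≤ ((((M : ℤ) * a).natAbs + ((c : ℤ) * u).natAbs) + ((k : ℤ) * u').natAbs) + v.natAbs := by
          gcongr; exact Int.natAbs_add_le _ _
      _ ≤ M * (a.natAbs + 2) + v.natAbs := by rw [e1]; nlinarith

/-- Size of a bounded coordinate: `M (A + 2) + V < 2^{(Λ+5) + (n+2)} + 2^n ≤ 2^{Λ + n + 8}` for
`A, V < 2^n`. [folklore] -/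
theorem size_coord_le {Λ A V n : ℕ} (hA : A.size ≤ n) (hV : V.size ≤ n) {X : ℕ} (hX : X ≤ bigM Λ * (A + 2) + V) :
    X.size ≤ Λ + n + 8 := by
  rw [Nat.size_le] at hA hV ⊢
  have hM := bigM_lt_two_pow Λ
  have h2 : (2 : ℕ) ^ 1 = 2 := rfl
  have hA2 : A + 2 < 2 ^ (n + 2) := by rw [pow_add]; omega
  have h3 : bigM Λ * (A + 2) < 2 ^ (Λ + 5) * 2 ^ (n + 2) :=
    Nat.mul_lt_mul_of_lt_of_le hM hA2.le (by positivity)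
  rw [← pow_add] at h3
  have h4 : 2 ^ (Λ + 5 + (n + 2)) + 2 ^ n ≤ 2 ^ (Λ + n + 8) := by
    have : 2 ^ n ≤ 2 ^ (Λ + 5 + (n + 2)) := Nat.pow_le_pow_right (by norm_num) (by omega)
    calc 2 ^ (Λ + 5 + (n + 2)) + 2 ^ n ≤ 2 ^ (Λ + 5 + (n + 2)) + 2 ^ (Λ + 5 + (n + 2)) := by omega
      _ = 2 ^ (Λ + n + 8) := by rw [← two_mul, ← pow_succ']; congr 1; omega
  omega

/-- The clipping constant of the generator. [folklore] -/
def pieceClip : ℕ := 250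

/-- **The pieces are short on the generator's trajectory**: for a presentation whose drawn
paths are grid chains (true for a valid drawing), with `1 ≤ Λ`, every piece is at most
`pieceClip · (|ctx| + 1)` symbols long — so clipping the piece function at that size
(`Brick.clipF`, for the unconditional growth bound of the fold) does not change its values there.
[folklore] -/
theorem length_pieceFn_argOf_le (P : List GridPoint) {D : List DrawnEdge}
    (hch : ∀ d ∈ D, List.IsChain IsGridEdge d.2.2) (s t : ℕ) {Λ : ℕ} (hΛ : 1 ≤ Λ) (v : GridPoint) (i : ℕ) :
    (pieceFn (argOf P D s t Λ v i)).length ≤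
      pieceClip * ((ctx (encodingDrawnGraphInstance.encode (P, D, s, t)) Λ v).length + 1) := by
  rw [pieceFn_argOf, pieceFlat_eq]
  by_cases hr : ∃ he : idxE Λ i < D.length, idxQ Λ i + 1 < (D[idxE Λ i]).2.2.length ∧
      idxM Λ i ≤ 2 * hgt Λ (D[idxE Λ i]) (idxQ Λ i) (idxT Λ i)
  · obtain ⟨he, hq, hm⟩ := hr
    rw [pieceAt_of_range _ he hq hm, length_boolPair, cV_eq, length_boolPair, List.length_nil]
    -- names
    set w := encodingDrawnGraphInstance.encode (P, D, s, t) with hw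
    set d := D[idxE Λ i] with hdd
    set q := idxQ Λ i
    set tt := idxT Λ i
    set m := idxM Λ i
    have hdD : d ∈ D := List.getElem_mem he
    have hq' : q < d.2.2.length := by omega
    -- the base point, the unit step, their sizes
    have ea : d.2.2.getD q 0 = d.2.2[q] := List.getD_eq_getElem _ _ hq'
    have eb : d.2.2.getD (q + 1) 0 = d.2.2[q + 1] := List.getD_eq_getElem _ _ hq
    have hu : IsUnitVec (d.2.2[q + 1] - d.2.2[q]) := isUnitVec_step (hch d hdD) hq
    have hu1 : (d.2.2[q + 1] - d.2.2[q]).1.natAbs ≤ 1 ∧ (d.2.2[q + 1] - d.2.2[q]).2.natAbs ≤ 1 := by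
      rcases hu.cases with ⟨h1, h2⟩ | ⟨h1, h2⟩ | ⟨h1, h2⟩ | ⟨h1, h2⟩ <;> simp [h1, h2]
    have hw_ctx : w.length ≤ (ctx w Λ v).length := by rw [ctx, length_boolPair]; omega
    have hΛ_ctx : Λ ≤ (ctx w Λ v).length := by
      rw [ctx, length_boolPair, length_boolPair]; simp [ones]; omega
    have hv_ctx : (dpEnc v.1).length ≤ (ctx w Λ v).length ∧ (dpEnc v.2).length ≤ (ctx w Λ v).length := by
      rw [ctx, length_boolPair, length_boolPair, length_boolPair]; omega
    have hpt := length_encPt_le P s t hdD (List.getElem_mem hq')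
    have hsz := size_natAbs_le_length_encPt (d.2.2[q])
    -- index bounds: t < M, height parameters ≤ M
    obtain ⟨hB, hK₂, -⟩ := radix_pos hΛ
    have htM : tt < bigM Λ := by
      show idxT Λ i < bigM Λ
      unfold idxT
      have hx := Nat.mod_lt (i % (Λ * (bigM Λ * radixB Λ))) hK₂
      exact Nat.div_lt_of_lt_mul (lt_of_lt_of_eq hx (Nat.mul_comm _ _))
    have hhgt : hgt Λ d q tt ≤ 6 * Λ := by unfold hgt; split_ifs <;> omega
    have hM : bigM Λ = 24 * Λ := rfl
    -- each translated block point has short code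
    have key : ∀ j, j ≤ m + 1 → (encPt (blockPt Λ d q tt j + v)).length ≤ 6 * (ctx w Λ v).length + 38 := by
      intro j hj
      have hn : ∀ {z : ℤ}, z = (d.2.2[q]).1 ∨ z = (d.2.2[q]).2 → z.natAbs.size ≤ (ctx w Λ v).length := by
        rintro z (rfl | rfl)
        · exact hsz.1.trans (hpt.trans hw_ctx)
        · exact hsz.2.trans (hpt.trans hw_ctx)
      have hvn : v.1.natAbs.size ≤ (ctx w Λ v).length ∧ v.2.natAbs.size ≤ (ctx w Λ v).length :=
        ⟨(size_natAbs_le_length_dpEnc _).trans hv_ctx.1, (size_natAbs_le_length_dpEnc _).trans hv_ctx.2⟩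
      refine (length_encPt_le_of_size (n := Λ + (ctx w Λ v).length + 8) ?_ ?_).trans (by omega)
      · rw [blockPt, towerBlockPt, ea, eb, Prod.fst_add]
        split_ifs with hjh
        · rw [towerPt_fst]
          refine size_coord_le (hn (Or.inl rfl)) hvn.1 (natAbs_coord_le (by omega) (by omega) hu1.1 hu1.2).1
        · rw [towerPt_fst]
          refine size_coord_le (hn (Or.inl rfl)) hvn.1 (natAbs_coord_le (by omega) (by omega) hu1.1 hu1.2).1
      · rw [blockPt, towerBlockPt, ea, eb, Prod.snd_add]
        split_ifs with hjh
        · rw [towerPt_snd]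
          refine size_coord_le (hn (Or.inr rfl)) hvn.2 (natAbs_coord_le (by omega) (by omega) hu1.2 hu1.1).2
        · rw [towerPt_snd]
          refine size_coord_le (hn (Or.inr rfl)) hvn.2 (natAbs_coord_le (by omega) (by omega) hu1.2 hu1.1).2
    have k1 := key m (by omega)
    have k2 := key (m + 1) le_rfl
    simp only [pieceClip]
    omega
  · rw [pieceAt_of_not_range _ hr]
    simp


/-! ### The items generator: folding the clipped pieces -/

/-- The round polynomial `336 (X + 1)⁴ ≥ |D| · Λ · 24Λ · (12Λ + 2)`. [folklore] -/
def genPoly : Polynomial ℕ := 336 * (X + 1) ^ 4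

/-- Evaluation of `genPoly`. [folklore] -/
@[simp] theorem genPoly_eval (n : ℕ) : genPoly.eval n = 336 * (n + 1) ^ 4 := by simp [genPoly]

/-- The initial record of the generator's fold: `⟨ctx, ⟨bin (genPoly |ctx|), ⟨1⁰, ε⟩⟩⟩`.
[folklore] -/
def genInitF : List Bool → List Bool :=
  fanoutFn (fun x => x) (fanoutFn (HashBricks.popCountFn ∘ Plumb.polyFn genPoly) fun _ => boolPair [] [])

/-- **The items generator**: fold the clipped piece function over `genPoly |ctx|` positions and
return the accumulator — the framed items of the code of `E₂ + v`.
[cite: LiskiewiczOgiharaToda2003, §4 (proof of Theorem 7: R₁ computes E₂)] -/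
def genItemsFn : List Bool → List Bool :=
  sndPow 2 ∘ foldLoop appF (clipF pieceClip pieceFn) genPoly ∘ genInitF

/-- `genInitF ∈ FP`. [folklore] -/
theorem genInitF_mem_FP : genInitF ∈ FP :=
  fanoutFn_mem_FP (PolyTimeComputable.id _) (fanoutFn_mem_FP
    (comp_mem_FP HashBricks.popCountFn_mem_FP (Plumb.polyFn_mem_FP genPoly)) (const_mem_FP _))

/-- **`genItemsFn ∈ FP`** (the clipped fold of `FoldBricks.lean`). [cite: AroraBarak2009, §1.3 (bounded loops)] -/
theorem genItemsFn_mem_FP : genItemsFn ∈ FP :=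
  comp_mem_FP (sndPow_mem_FP 2) (comp_mem_FP
    (foldLoop_clipF_mem_FP pieceClip appF_mem_FP length_appF_le pieceFn_mem_FP genPoly) genInitF_mem_FP)

/-- Value of `genInitF`. [folklore] -/
theorem genInitF_apply (x : List Bool) :
    genInitF x = boolPair x (boolPair (encodeNat (genPoly.eval x.length)) (boolPair (ones 0) [])) := by
  simp [genInitF, ones]

/-- Past the last position every flat piece is empty. [folklore] -/
theorem pieceFlat_eq_nil_of_le {Λ : ℕ} (hΛ : 1 ≤ Λ) (D : List DrawnEdge) (c : GridPoint × GridPoint → List Bool)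
    {i : ℕ} (hi : totalPieces Λ D ≤ i) : pieceFlat Λ D c i = [] := by
  rw [pieceFlat_eq, pieceAt, List.getElem?_eq_none]
  rw [idxE, Nat.le_div_iff_mul_le (radix_pos hΛ).2.2]
  exact hi

/-- `totalPieces ≤ genPoly |ctx|`. [folklore] -/
theorem totalPieces_le (P : List GridPoint) (D : List DrawnEdge) (s t : ℕ) (v : GridPoint) :
    totalPieces (maxEdges D) D ≤
      genPoly.eval (ctx (encodingDrawnGraphInstance.encode (P, D, s, t)) (maxEdges D) v).length := by
  set n := (ctx (encodingDrawnGraphInstance.encode (P, D, s, t)) (maxEdges D) v).length with hn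
  have hΛ : maxEdges D ≤ n := by
    rw [hn, ctx, length_boolPair, length_boolPair]; simp [ones]; omega
  have hD : D.length ≤ n := by
    rw [hn, ctx, length_boolPair, encDG_eq, length_boolPair, length_boolPair, length_boolPair]; simp [ones]; omega
  rw [genPoly_eval, totalPieces, bigM, radixB]
  have e4 : (n + 1) ^ 4 = (n + 1) * (n + 1) * (n + 1) * (n + 1) := by ring
  calc D.length * (maxEdges D * (24 * maxEdges D * (12 * maxEdges D + 2)))
      ≤ n * (n * (24 * n * (12 * n + 2))) := by gcongr
    _ ≤ (n + 1) * ((n + 1) * (24 * (n + 1) * (14 * (n + 1)))) := by gcongr <;> omega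
    _ = 336 * (n + 1) ^ 4 := by rw [e4]; ring

/-- **The items generator computes the items of the code of `E₂ + v`.** For a valid drawing,
with the context of its canonical code, `Λ = maxEdges D` and the translation `v`:
`genItemsFn ctx = framesOf (cV v) (drawnEdges (uniformize P D).2)`.
[cite: LiskiewiczOgiharaToda2003, §4 (proof of Theorem 7: R₁(x) = (E₂, τ, h))] -/
theorem genItemsFn_ctx {P : List GridPoint} {D : List DrawnEdge} (hD : IsGridDrawing P D) (s t : ℕ) (v : GridPoint) :
    genItemsFn (ctx (encodingDrawnGraphInstance.encode (P, D, s, t)) (maxEdges D) v) =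
      framesOf (cV v) (drawnEdges (uniformize P D).2) := by
  set x := ctx (encodingDrawnGraphInstance.encode (P, D, s, t)) (maxEdges D) v with hx
  have hΛ : 1 ≤ maxEdges D := one_le_maxEdges D
  have hch : ∀ d ∈ D, List.IsChain IsGridEdge d.2.2 := fun d hd => (hD.2.1 d hd).2.2.2.2.2.2.1
  have h2 : ∀ d ∈ D, 2 ≤ d.2.2.length := fun d hd => two_le_length_of_isDrawnEdgeOf hD.1 (hD.2.1 d hd)
  rw [genItemsFn, Function.comp_apply, Function.comp_apply, genInitF_apply,
    foldLoop_apply _ _ le_rfl, sndPow]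
  simp only [Function.comp_apply, sndPow, sndF_boolPair]
  rw [foldAcc_clipF (fun j _ _ => ?_), foldAcc_appF, List.nil_append,
    framesOf_drawnEdges_uniformize P h2 (cV v)]
  · symm
    rw [← ccat_eq_ccat_of_le (totalPieces_le P D s t v) (fun i hi => ?_)]
    · exact ccat_congr fun i _ => by rw [Nat.zero_add]; exact (pieceFn_argOf P D s t (maxEdges D) v i).symm
    · exact pieceFlat_eq_nil_of_le hΛ D _ hi
  · exact length_pieceFn_argOf_le P hch s t hΛ v j

end TowerGen

end Literature.Barriers.CriticalPhenomena.GridSAW
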